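import Mathlib
import Summits.ValiantsHypothesis.ValiantsHypothesis.Theorems.BarrierLeverPartitionMinorsHitByVPSimplexJoinBoxGameLayerCake

/-!
# Route BarrierLever — item `PartitionMinorsHitByVP` (stmt-ValiantsHypothesis-19717), line `hidden_states`:
# THE FIRST NO-GO INSIDE THE BOX GAME — no winning predicate holds at a position of `≤ hd + 1` columns containing a 2×2 sub-box

Helper file (`--supports stmt-ValiantsHypothesis-19717`; cell valiant-natproofs, rung V4, 𝒟-side door (c), line
`Cruxes/PartitionMinorsHitByVP/Lines/hidden_states.lean` v8, registered stub `stub_simplexPairLower`; prover seat val-np-p3 gen 14).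
Definition-free. Closes NO item; it is a NECESSARY CONDITION on every box-game winning predicate `W` (p647518 / p656478 interface).

THE POINT (memo val-np-p3 g14 «box game census» §1, the `t = 1` case of the DIMENSION LAW, kernel form). Let `W` satisfy the box-game
hypothesis (crude floor `⌊(r−2)/hd⌋ + 1 ≤ r₁`; the sharp-floor hypothesis of p656478 has the same demand `r₁ = 1` available when
`r ≤ hd + 1`, see `not_boxWinning_rect_layerCake`). If a position `e : Fin r → columns` with `r ≤ hd + 1` contains a COMBINATORIAL RECTANGLE —
four distinct indices `i a b` (`a b : Fin 2`) in one piece whose values, in every slot, depend only on `a` or only on `b` — then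
`¬ W hd r e` (`not_boxWinning_rect`). Proof = the exact-census mechanism: the demand `(r₀, r₁) = (r − 1, 1)` is legal at every such
position; a one-slot two-colouring colours the four rectangle columns in pairs, so the single `true` column is not one of them; hence the
rectangle survives into the `W`-position `e ∘ g₀` with `r − 1 ≤ (hd − 1) + 1` columns, and induction on `r` ends at `r ≤ 3 < 4`. This is the
volume threshold `v*(n, (2,2)) = n + 2` of the census (a 2×2 box needs at least `n − 2` units of company) and, one level up, the reason a
`d`-dimensional box needs volume `> Σ_{j<d} C(hd, j)`: the game has necessary conditions on SHAPES, not only on volumes, and any `∀h`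
winning invariant must carry them.

WHAT THIS IS NOT: no statement about which designs win; item 19717 and `Stmt.simplexPairLower` stay OPEN; nothing on crux 14610 or VP ≠ VNP.
-/

set_option linter.dupNamespace false

namespace Summit.ValiantsHypothesis.ValiantsHypothesis.Theorems.BarrierLever.SimplexJoin.Cut

open Finset

noncomputable section

variable {m D N : ℕ}

/-- **No box-game winning predicate holds at a short position containing a 2×2 sub-box** (crude floor). For every `W` satisfying the
box-game hypothesis of p647518, every `hd`, every `r ≤ hd + 1` and every `e : Fin r → Fin m × (Fin D → Option (Fin N))` containing four
distinct columns `e (i a b)` of one piece whose value in each slot depends only on `a` or only on `b`: `¬ W hd r e`. -/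
theorem not_boxWinning_rect (W : (hd : ℕ) → (r : ℕ) → (Fin r → Fin m × (Fin D → Option (Fin N))) → Prop)
    (hwin : ∀ (hd r : ℕ) (e : Fin r → Fin m × (Fin D → Option (Fin N))), W hd r e → 2 ≤ r → 1 ≤ hd →
      ∀ r₀ r₁ : ℕ, r₀ + r₁ = r → (r - 2) / hd + 1 ≤ r₁ → r₁ ≤ r₀ → r₀ ≤ 2 ^ (hd - 1) →
        ∃ (f : Fin m → Fin D) (side : Fin m → Option (Fin N) → Bool) (g₀ : Fin r₀ → Fin r) (g₁ : Fin r₁ → Fin r),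
          Function.Injective (Sum.elim g₀ g₁) ∧
          (∀ j, side (e (g₀ j)).1 ((e (g₀ j)).2 (f (e (g₀ j)).1)) = false) ∧
          (∀ j, side (e (g₁ j)).1 ((e (g₁ j)).2 (f (e (g₁ j)).1)) = true) ∧
          W (hd - 1) r₀ (fun j => e (g₀ j)) ∧ W (hd - 1) r₁ (fun j => e (g₁ j))) :
    ∀ (r hd : ℕ) (e : Fin r → Fin m × (Fin D → Option (Fin N))) (i : Fin 2 → Fin 2 → Fin r),
      r ≤ hd + 1 → (∀ a b a' b', i a b = i a' b' → a = a' ∧ b = b') →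
      (∀ a b, (e (i a b)).1 = (e (i 0 0)).1) →
      (∀ φ : Fin D, (∀ a b, (e (i a b)).2 φ = (e (i a 0)).2 φ) ∨ (∀ a b, (e (i a b)).2 φ = (e (i 0 b)).2 φ)) →
      ¬ W hd r e := by
  intro r
  induction r using Nat.strong_induction_on with
  | _ r IH =>
  intro hd e i hr hinj hpiece hrect hW
  classical
  -- four distinct indices force `4 ≤ r`
  have hcard : 4 ≤ r := by
    have hi : Function.Injective (fun ab : Fin 2 × Fin 2 => i ab.1 ab.2) := by
      rintro ⟨a, b⟩ ⟨a', b'⟩ h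
      obtain ⟨ha, hb⟩ := hinj a b a' b' h
      simp [ha, hb]
    have := Fintype.card_le_of_injective _ hi
    simpa [Fintype.card_fin, Fintype.card_prod] using this
  -- the demand (r − 1, 1) is legal
  have h2r : 2 ≤ r := by omega
  have hhd : 1 ≤ hd := by omega
  have hfloor : (r - 2) / hd + 1 ≤ 1 := by
    have : (r - 2) / hd = 0 := Nat.div_eq_of_lt (by omega)
    omega
  have hpow : r - 1 ≤ 2 ^ (hd - 1) := by
    have h1 : hd ≤ 2 ^ (hd - 1) := by
      have key : ∀ n : ℕ, n + 1 ≤ 2 ^ n := fun n => Nat.lt_two_pow_self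
      rcases Nat.exists_eq_add_of_le hhd with ⟨k, rfl⟩
      simpa [Nat.add_sub_cancel_left, add_comm] using key k
    omega
  obtain ⟨f, side, g₀, g₁, hg, hfalse, htrue, hW0, -⟩ := hwin hd r e hW h2r hhd (r - 1) 1 (by omega) hfloor (by omega) hpow
  -- colour of a column
  set col : Fin r → Bool := fun k => side (e k).1 ((e k).2 (f (e k).1)) with hcol
  -- the four rectangle columns are coloured in pairs
  have hpair : ∀ a b, ∃ a' b', i a' b' ≠ i a b ∧ col (i a' b') = col (i a b) := by
    intro a b
    have hp : (e (i a b)).1 = (e (i 0 0)).1 := hpiece a b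
    rcases hrect (f (e (i 0 0)).1) with hrow | hcolm
    · -- value depends only on `a`: partner (a, b') with b' ≠ b
      obtain ⟨b', hb'⟩ : ∃ b' : Fin 2, b' ≠ b := ⟨b + 1, by fin_cases b <;> decide⟩
      refine ⟨a, b', fun h => hb' (hinj _ _ _ _ h).2, ?_⟩
      simp only [hcol, hpiece a b', hp, hrow a b', hrow a b]
    · obtain ⟨a', ha'⟩ : ∃ a' : Fin 2, a' ≠ a := ⟨a + 1, by fin_cases a <;> decide⟩
      refine ⟨a', b, fun h => ha' (hinj _ _ _ _ h).1, ?_⟩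
      simp only [hcol, hpiece a' b, hp, hcolm a' b, hcolm a b]
  -- `Sum.elim g₀ g₁` is a bijection
  have hsurj : Function.Surjective (Sum.elim g₀ g₁) := by
    have hbij := (Fintype.bijective_iff_injective_and_card _).mpr ⟨hg, by simp [Fintype.card_sum, Fintype.card_fin]; omega⟩
    exact hbij.2
  -- no rectangle column is the `true` column
  have hnot1 : ∀ a b, i a b ≠ g₁ 0 := by
    intro a b h
    obtain ⟨a', b', hne, hc⟩ := hpair a b
    have ht : col (i a b) = true := by rw [h]; exact htrue 0
    obtain ⟨s, hs⟩ := hsurj (i a' b')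
    rcases s with j | j
    · have hf' : col (i a' b') = false := by rw [← hs]; exact hfalse j
      rw [hc, ht] at hf'
      exact Bool.noConfusion hf'
    · have hj : j = 0 := Subsingleton.elim _ _
      subst hj
      exact hne (by rw [← hs]; exact h.symm ▸ rfl)
  -- pull the rectangle back along `g₀`
  have hpre : ∀ a b, ∃ j, g₀ j = i a b := by
    intro a b
    obtain ⟨s, hs⟩ := hsurj (i a b)
    rcases s with j | j
    · exact ⟨j, hs⟩
    · have hj : j = 0 := Subsingleton.elim _ _
      subst hj
      exact absurd hs.symm (hnot1 a b)
  choose j hj using hpre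
  refine IH (r - 1) (by omega) (hd - 1) (fun k => e (g₀ k)) j (by omega) ?_ ?_ ?_ hW0
  · intro a b a' b' h
    exact hinj a b a' b' (by rw [← hj a b, ← hj a' b', h])
  · intro a b
    simp only [hj]
    exact hpiece a b
  · intro φ
    simp only [hj]
    exact hrect φ

/-- **The same no-go for the sharp (layer-cake) floor** of p656478: at `r ≤ hd + 1` the layer-cake sum is `r − 1 ≤ hd`, so the demand
`r₁ = 1` is still legal and the argument of `not_boxWinning_rect` applies verbatim (we reduce to it by weakening the hypothesis on the
finitely many positions involved — formally, by running the same induction). -/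
theorem not_boxWinning_rect_layerCake (W : (hd : ℕ) → (r : ℕ) → (Fin r → Fin m × (Fin D → Option (Fin N))) → Prop)
    (hwin : ∀ (hd r : ℕ) (e : Fin r → Fin m × (Fin D → Option (Fin N))), W hd r e → 2 ≤ r → 1 ≤ hd →
      ∀ r₀ r₁ : ℕ, r₀ + r₁ = r →
        (∑ d ∈ Finset.range hd, (r - ∑ j ∈ Finset.range (d + 1), hd.choose j) + hd - 1) / hd ≤ r₁ → r₁ ≤ r₀ → r₀ ≤ 2 ^ (hd - 1) →
        ∃ (f : Fin m → Fin D) (side : Fin m → Option (Fin N) → Bool) (g₀ : Fin r₀ → Fin r) (g₁ : Fin r₁ → Fin r),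
          Function.Injective (Sum.elim g₀ g₁) ∧
          (∀ j, side (e (g₀ j)).1 ((e (g₀ j)).2 (f (e (g₀ j)).1)) = false) ∧
          (∀ j, side (e (g₁ j)).1 ((e (g₁ j)).2 (f (e (g₁ j)).1)) = true) ∧
          W (hd - 1) r₀ (fun j => e (g₀ j)) ∧ W (hd - 1) r₁ (fun j => e (g₁ j))) :
    ∀ (r hd : ℕ) (e : Fin r → Fin m × (Fin D → Option (Fin N))) (i : Fin 2 → Fin 2 → Fin r),
      r ≤ hd + 1 → (∀ a b a' b', i a b = i a' b' → a = a' ∧ b = b') →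
      (∀ a b, (e (i a b)).1 = (e (i 0 0)).1) →
      (∀ φ : Fin D, (∀ a b, (e (i a b)).2 φ = (e (i a 0)).2 φ) ∨ (∀ a b, (e (i a b)).2 φ = (e (i 0 b)).2 φ)) →
      ¬ W hd r e := by
  -- restrict `W` to short positions, where the two floors agree on the demand `r₁ = 1`
  let W' : (hd : ℕ) → (r : ℕ) → (Fin r → Fin m × (Fin D → Option (Fin N))) → Prop := fun hd r e => r ≤ hd + 1 ∧ W hd r e
  intro r hd e i hr hinj hpiece hrect hW
  refine not_boxWinning_rect W' ?_ r hd e i hr hinj hpiece hrect ⟨hr, hW⟩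
  rintro hd' r' e' ⟨hr', hW'⟩ h2 h1 r₀ r₁ hsum hfl h10 hpow
  -- at r' ≤ hd' + 1 the crude demand floor is 1, so r₁ ≥ 1 is all we know; the layer-cake floor is also ≤ 1 there
  have h1r : 1 ≤ r₁ := by
    have : (r' - 2) / hd' = 0 := Nat.div_eq_of_lt (by omega)
    omega
  have hS : (∑ d ∈ Finset.range hd', (r' - ∑ j ∈ Finset.range (d + 1), hd'.choose j) + hd' - 1) / hd' ≤ r₁ := by
    have hle : ∑ d ∈ Finset.range hd', (r' - ∑ j ∈ Finset.range (d + 1), hd'.choose j) ≤ r' - 1 := by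
      have hterm : ∀ d ∈ Finset.range hd', (r' - ∑ j ∈ Finset.range (d + 1), hd'.choose j) ≤ if d = 0 then r' - 1 else 0 := by
        intro d hd
        split_ifs with h0
        · subst h0; simp
        · have h2d : 2 ≤ d + 1 := by omega
          have h2le : ∑ j ∈ Finset.range 2, hd'.choose j ≤ ∑ j ∈ Finset.range (d + 1), hd'.choose j :=
            Finset.sum_le_sum_of_subset (Finset.range_subset_range.mpr h2d)
          have : ∑ j ∈ Finset.range 2, hd'.choose j = 1 + hd' := by simp [Finset.sum_range_succ]
          have : r' ≤ ∑ j ∈ Finset.range (d + 1), hd'.choose j := by omega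
          simp [Nat.sub_eq_zero_of_le this]
      calc ∑ d ∈ Finset.range hd', (r' - ∑ j ∈ Finset.range (d + 1), hd'.choose j)
          ≤ ∑ d ∈ Finset.range hd', (if d = 0 then r' - 1 else 0) := Finset.sum_le_sum hterm
        _ = r' - 1 := by rw [Finset.sum_ite_eq']; simp [Finset.mem_range.mpr h1]
    have hq : (∑ d ∈ Finset.range hd', (r' - ∑ j ∈ Finset.range (d + 1), hd'.choose j) + hd' - 1) / hd' ≤ 1 := by
      calc (∑ d ∈ Finset.range hd', (r' - ∑ j ∈ Finset.range (d + 1), hd'.choose j) + hd' - 1) / hd'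
          ≤ (r' - 1 + hd' - 1) / hd' := Nat.div_le_div_right (by omega)
        _ ≤ 1 := by
            apply Nat.le_of_lt_succ
            apply Nat.div_lt_of_lt_mul
            omega
    omega
  obtain ⟨f, side, g₀, g₁, hg, hfalse, htrue, hW0, hW1⟩ := hwin hd' r' e' hW' h2 h1 r₀ r₁ hsum hS h10 hpow
  exact ⟨f, side, g₀, g₁, hg, hfalse, htrue, ⟨by omega, hW0⟩, ⟨by omega, hW1⟩⟩

end

end Summit.ValiantsHypothesis.ValiantsHypothesis.Theorems.BarrierLever.SimplexJoin.Cut
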